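import Literature.Analysis.FluidPDE.JetStressAlgebra
import Literature.Analysis.FluidPDE.CLStressPointwise
import Literature.Analysis.FluidPDE.CLEstimateTools
import Literature.Analysis.FluidPDE.CLVelocityEstimates
import Literature.Analysis.FunctionSpaces.TorusImprovedHolder
import Literature.Analysis.FunctionSpaces.TorusHolderBridge
import HarnessLib

/-!
# The intermittent-jet perturbation: velocity estimates (BV §7.5, (7.40)–(7.46))

Analysis/FluidPDE support file (everything proved) for the estimates of the perturbation `D.w`
of `JetPerturbation` (Buckmaster–Vicol, EMS Surv. Math. Sci. 6 (2019), §7.5.4 (7.40)–(7.46)),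
under two packages of hypotheses: `AmpBounds` (sup bounds of the amplitudes `a_x`, `hsq_x = a_x²`
and their first/second/mixed derivatives, delivered by `JAmp.jamp_package`) and the jet bounds
`Jet.Bounds B` of `IntermittentJetBounds` for every direction and time. Contents: pointwise
majorants and the resulting sup / `L¹` / `L²` bounds of `w^{(p)}`, of the correctors
`w^{(c)} = wpc - wp`, `X`, `∇ζ`, and of their first space/time derivatives; in particular the
energy bound `∫‖w^{(p)}‖² ≤ 9 N (∫ρ + 6H₁σ⁻¹)` by the improved Hölder inequality
(`Torus.eLpNorm_smul_le_of_latticeInvariant`, `p = 1`, using the `σ⁻¹`-periodicity of `η²ψ̃²`;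
BV (7.32), (7.40)).

## References

* T. Buckmaster, V. Vicol, EMS Surv. Math. Sci. 6 (2019) = arXiv:1901.09023, §7.5.2 (7.32),
  §7.5.4 (7.40)–(7.46). [`BuckmasterVicol2020`]
-/

noncomputable section

open MeasureTheory Set Filter Topology Function
open scoped InnerProductSpace ContDiff ENNReal NNReal

namespace Literature.Analysis.FluidPDE

namespace JetStep

open Literature.Analysis.FunctionSpaces FunctionSpaces.Torus Mikado NashGeometric Jet

local notation "𝕋³" => UnitAddTorus (Fin 3)
local notation "E³" => EuclideanSpace ℝ (Fin 3)
local notation "Idx" => Index (Fin 3)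

/-! ## Generic tools -/

section Tools

/-- The number of directions, as a real number. [folklore] -/
def NN : ℝ := (Fintype.card Idx : ℝ)

/-- `1 ≤ N`. [folklore] -/
theorem one_le_NN : (1 : ℝ) ≤ NN := by
  have : 1 ≤ Fintype.card Idx := Fintype.card_pos
  unfold NN; exact_mod_cast this

/-- `∑_x c ≤ N c`. [folklore] -/
theorem sum_const_le (c : ℝ) : ∑ _x : Idx, c ≤ NN * c := by
  rw [Finset.sum_const, Finset.card_univ, nsmul_eq_mul]; rfl

/-- `∑_x f x ≤ N c` if `f ≤ c`. [folklore] -/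
theorem sum_le_NN_mul {f : Idx → ℝ} {c : ℝ} (h : ∀ x, f x ≤ c) : ∑ x, f x ≤ NN * c :=
  (Finset.sum_le_sum fun x _ => h x).trans (by rw [Finset.sum_const, Finset.card_univ, nsmul_eq_mul]; rfl)

/-- `|k_x| ≤ 3`, `|(k_x)_j| ≤ 2`, `|k_x|² ≤ 5`. [folklore] -/
theorem abs_dir_le (x : Idx) (j : Fin 3) : |((dir x j : ℤ) : ℝ)| ≤ 3 := by
  have h1 : |((dir x j : ℤ) : ℝ)| ≤ ‖dirVec x‖ := by
    have : (dirVec x) j = (dir x j : ℝ) := by simp [dirVec]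
    rw [← this, ← Real.norm_eq_abs]; exact PiLp.norm_apply_le (dirVec x) j
  exact h1.trans (CL22.norm_dirVec_le x)

/-- `|k_x|² ≤ 5`. [folklore] -/
theorem dirNormSq_le' (x : Idx) : dirNormSq x ≤ 5 := CL22.dirNormSq_le x

/-- `∫ |f| |g| ≤ (sup |f|) ∫ |g|`-type bound. [folklore] -/
theorem integral_mul_le_sup_mul {f g : 𝕋³ → ℝ} (hf : Continuous f) (hg : Continuous g) {A I : ℝ} (hA : ∀ y, |f y| ≤ A)
    (hI : ∫ y, |g y| ≤ I) : ∫ y, |f y * g y| ≤ A * I := by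
  have hA0 : 0 ≤ A := (abs_nonneg _).trans (hA 0)
  calc ∫ y, |f y * g y| ≤ ∫ y, A * |g y| := integral_mono (hf.mul hg).abs.integrable_unitAddTorus
        (continuous_const.mul hg.abs).integrable_unitAddTorus fun y => by rw [abs_mul]; exact mul_le_mul_of_nonneg_right (hA y) (abs_nonneg _)
    _ = A * ∫ y, |g y| := integral_const_mul _ _
    _ ≤ A * I := mul_le_mul_of_nonneg_left hI hA0

/-- From `eLpNorm f 1 ≤ ofReal K` to `∫ ‖f‖ ≤ K` for continuous `f`. [folklore] -/
theorem integral_norm_le_of_eLpNorm_one_le {F : Type*} [NormedAddCommGroup F] {f : 𝕋³ → F} (hf : Continuous f) {K : ℝ}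
    (hK : 0 ≤ K) (h : eLpNorm f 1 volume ≤ ENNReal.ofReal K) : ∫ y, ‖f y‖ ≤ K := by
  have hi : Integrable f volume := hf.integrable_unitAddTorus
  have e : eLpNorm f 1 volume = ENNReal.ofReal (∫ y, ‖f y‖) := by
    rw [eLpNorm_one_eq_lintegral_enorm, ofReal_integral_norm_eq_lintegral_enorm hi]
  rw [e] at h
  exact (ENNReal.ofReal_le_ofReal_iff hK).1 h

/-- From `eLpNorm f p ≤ ofReal K`, `1 ≤ p`, to `∫ ‖f‖ ≤ K` (probability space). [folklore] -/
theorem integral_norm_le_of_eLpNorm_le {F : Type*} [NormedAddCommGroup F] {f : 𝕋³ → F} (hf : Continuous f) {K : ℝ}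
    (hK : 0 ≤ K) {p : ℝ≥0∞} (hp : 1 ≤ p) (h : eLpNorm f p volume ≤ ENNReal.ofReal K) : ∫ y, ‖f y‖ ≤ K :=
  integral_norm_le_of_eLpNorm_one_le hf hK ((eLpNorm_le_eLpNorm_of_exponent_le hp hf.aestronglyMeasurable).trans h)

/-- From `∫ |m| ≤ K` to `eLpNorm m 1 ≤ ofReal K` for continuous real `m`. [folklore] -/
theorem eLpNorm_one_le_of_integral_abs_le {m : 𝕋³ → ℝ} (hm : Continuous m) {K : ℝ} (h : ∫ y, |m y| ≤ K) :
    eLpNorm m 1 volume ≤ ENNReal.ofReal K := by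
  have hi : Integrable m volume := hm.integrable_unitAddTorus
  rw [eLpNorm_one_eq_lintegral_enorm, ← ofReal_integral_norm_eq_lintegral_enorm hi]
  exact ENNReal.ofReal_le_ofReal (by simpa [Real.norm_eq_abs] using h)

/-- From `∫ |m|^p ≤ K` (`1 ≤ p`) to `eLpNorm m p ≤ ofReal (K^{1/p})` for continuous real `m`. [folklore] -/
theorem eLpNorm_le_of_integral_rpow_le {m : 𝕋³ → ℝ} (hm : Continuous m) {p : ℝ} (hp : 1 ≤ p) {K : ℝ}
    (h : ∫ y, |m y| ^ p ≤ K) : eLpNorm m (ENNReal.ofReal p) volume ≤ ENNReal.ofReal (K ^ (1 / p)) := by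
  have hp0 : 0 < p := by linarith
  obtain ⟨C, hC⟩ := isCompact_univ.exists_bound_of_continuousOn hm.continuousOn
  have hmem : MemLp m (ENNReal.ofReal p) volume :=
    (memLp_top_of_bound hm.aestronglyMeasurable C (Eventually.of_forall fun y => hC y (mem_univ y))).mono_exponent le_top
  rw [hmem.eLpNorm_eq_integral_rpow_norm (by simpa using hp0) ENNReal.ofReal_ne_top, ENNReal.toReal_ofReal hp0.le, ← one_div]
  refine ENNReal.ofReal_le_ofReal (Real.rpow_le_rpow (integral_nonneg fun y => by positivity) ?_ (by positivity))
  simpa [Real.norm_eq_abs] using h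

/-- `L²` real form: `∫ ‖f‖² ≤ A` and `∫ ‖g‖² ≤ B` give `∫ ‖f‖‖g‖ ≤ √A √B`. [folklore] -/
theorem integral_norm_mul_norm_le {F G : Type*} [NormedAddCommGroup F] [NormedAddCommGroup G] {f : 𝕋³ → F} {g : 𝕋³ → G}
    (hf : Continuous f) (hg : Continuous g) {A B : ℝ} (hA : ∫ y, ‖f y‖ ^ 2 ≤ A) (hB : ∫ y, ‖g y‖ ^ 2 ≤ B) :
    ∫ y, ‖f y‖ * ‖g y‖ ≤ Real.sqrt A * Real.sqrt B := by
  have h2 : ENNReal.ofReal (2 : ℝ) = 2 := by norm_num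
  have hfm : MemLp (fun y => ‖f y‖) (ENNReal.ofReal 2) volume := by
    rw [h2]; exact ((memLp_two_iff_integrable_sq_norm hf.aestronglyMeasurable).2 (hf.norm.pow 2).integrable_unitAddTorus).norm
  have hgm : MemLp (fun y => ‖g y‖) (ENNReal.ofReal 2) volume := by
    rw [h2]; exact ((memLp_two_iff_integrable_sq_norm hg.aestronglyMeasurable).2 (hg.norm.pow 2).integrable_unitAddTorus).norm
  have h := integral_mul_le_Lp_mul_Lq_of_nonneg (μ := (volume : Measure 𝕋³)) Real.HolderConjugate.two_two
    (Eventually.of_forall fun y => norm_nonneg (f y)) (Eventually.of_forall fun y => norm_nonneg (g y)) hfm hgm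
  refine h.trans ?_
  have e1 : ∫ y, ‖f y‖ ^ (2 : ℝ) = ∫ y, ‖f y‖ ^ 2 := integral_congr_ae (Eventually.of_forall fun y => Real.rpow_two _)
  have e2 : ∫ y, ‖g y‖ ^ (2 : ℝ) = ∫ y, ‖g y‖ ^ 2 := integral_congr_ae (Eventually.of_forall fun y => Real.rpow_two _)
  have hi0 : 0 ≤ ∫ y, ‖f y‖ ^ 2 := integral_nonneg_of_ae (Eventually.of_forall fun y => by positivity)
  have hj0 : 0 ≤ ∫ y, ‖g y‖ ^ 2 := integral_nonneg_of_ae (Eventually.of_forall fun y => by positivity)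
  rw [e1, e2, Real.sqrt_eq_rpow, Real.sqrt_eq_rpow]
  exact mul_le_mul (Real.rpow_le_rpow hi0 hA (by norm_num)) (Real.rpow_le_rpow hj0 hB (by norm_num))
    (Real.rpow_nonneg hj0 _) (Real.rpow_nonneg (hi0.trans hA) _)

/-- `∫ ‖f‖ ≤ √A` if `∫‖f‖² ≤ A` (probability space). [folklore] -/
theorem integral_norm_le_sqrt {F : Type*} [NormedAddCommGroup F] {f : 𝕋³ → F} (hf : Continuous f) {A : ℝ}
    (hA : ∫ y, ‖f y‖ ^ 2 ≤ A) : ∫ y, ‖f y‖ ≤ Real.sqrt A := by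
  have h := integral_norm_mul_norm_le hf (continuous_const (y := (1 : ℝ))) hA (B := 1) (by simp)
  simpa using h

/-- `(∑ᵢ cᵢ)² ≤ n ∑ᵢ cᵢ²` over the directions. [folklore] -/
theorem sq_sum_le (c : Idx → ℝ) : (∑ x, c x) ^ 2 ≤ NN * ∑ x, c x ^ 2 := by
  have h := sq_sum_le_card_mul_sum_sq (s := (Finset.univ : Finset Idx)) (f := c)
  simpa [NN] using h

end Tools

/-! ## The hypothesis packages -/

namespace Datum

/-- **Amplitude bounds**: sup bounds of `a_x`, `hsq_x` and of their first/second/mixed derivatives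
on `[0, T] × 𝕋³` (delivered by `JAmp.jamp_package`). [cite: BuckmasterVicol2020, §7.5.1 (7.29)] -/
structure AmpBounds (D : Datum) (A₀ A₁ A₂ H₁ H₂ : ℝ) : Prop where
  hA₀ : 0 ≤ A₀
  hA₁ : 0 ≤ A₁
  hA₂ : 0 ≤ A₂
  hH₁ : 0 ≤ H₁
  hH₂ : 0 ≤ H₂
  a_le : ∀ x, ∀ t ∈ Icc 0 D.T, ∀ y, |D.a x t y| ≤ A₀
  da_le : ∀ x, ∀ t ∈ Icc 0 D.T, ∀ y l, |Torus.partialDeriv l (D.a x t) y| ≤ A₁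
  dta_le : ∀ x, ∀ t ∈ Icc 0 D.T, ∀ y, |Torus.timeDerivWithin (Icc 0 D.T) (D.a x) t y| ≤ A₁
  dda_le : ∀ x, ∀ t ∈ Icc 0 D.T, ∀ y l m, |Torus.partialDeriv m (Torus.partialDeriv l (D.a x t)) y| ≤ A₂
  dtda_le : ∀ x, ∀ t ∈ Icc 0 D.T, ∀ y l, |Torus.timeDerivWithin (Icc 0 D.T) (fun s z => Torus.partialDeriv l (D.a x s) z) t y| ≤ A₂
  dh_le : ∀ x, ∀ t ∈ Icc 0 D.T, ∀ y l, |Torus.partialDeriv l (JAmp.hsq D.γ₀ D.M x t) y| ≤ H₁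
  dth_le : ∀ x, ∀ t ∈ Icc 0 D.T, ∀ y, |D.hdot x t y| ≤ H₁
  ddh_le : ∀ x, ∀ t ∈ Icc 0 D.T, ∀ y l m, |Torus.partialDeriv m (Torus.partialDeriv l (JAmp.hsq D.γ₀ D.M x t)) y| ≤ H₂
  dtdh_le : ∀ x, ∀ t ∈ Icc 0 D.T, ∀ y l,
    |Torus.timeDerivWithin (Icc 0 D.T) (fun s z => Torus.partialDeriv l (JAmp.hsq D.γ₀ D.M x s) z) t y| ≤ H₂

variable {D : Datum} (h : D.Valid) {A₀ A₁ A₂ H₁ H₂ B : ℝ} (hA : D.AmpBounds A₀ A₁ A₂ H₁ H₂)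
  (hB : ∀ x t, Jet.Bounds B (D.J x) D.s x t) (hB1 : 1 ≤ B)
include h

/-- `hsq_x ≤ A₀²`, `0 ≤ hsq_x`. [folklore] -/
theorem hsq_le (hA : D.AmpBounds A₀ A₁ A₂ H₁ H₂) (x : Idx) {t : ℝ} (ht : t ∈ Icc 0 D.T) (y : 𝕋³) :
    0 ≤ JAmp.hsq D.γ₀ D.M x t y ∧ JAmp.hsq D.γ₀ D.M x t y ≤ A₀ ^ 2 := by
  rw [← a_sq h]
  refine ⟨sq_nonneg _, ?_⟩
  have := hA.a_le x t ht y
  rw [← sq_abs]; exact pow_le_pow_left₀ (abs_nonneg _) this 2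

omit h in
/-- The parameters of `J x` are those of `D`. [folklore] -/
theorem J_params (x : Idx) : (D.J x).μ = D.μ ∧ (D.J x).κ = D.κ ∧ (D.J x).σ = D.σ := ⟨rfl, rfl, rfl⟩

omit h in
/-- Positivity facts. [folklore] -/
theorem pos (h : D.Valid) : 0 < D.μ ∧ 0 < D.κ ∧ (0 : ℝ) < D.σ ∧ 0 < D.mup ∧ 1 ≤ D.μ ∧ 1 ≤ D.κ ∧ (1 : ℝ) ≤ D.σ := by
  have hσ : (1 : ℝ) ≤ D.σ := by exact_mod_cast h.hσ
  exact ⟨by linarith [one_le_μ h], by linarith [h.hκ], by linarith, h.hmup, one_le_μ h, h.hκ, hσ⟩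

/-! ## The principal part `w^{(p)}` -/

omit h in
/-- **Pointwise majorant of `w^{(p)}`**: `‖wp(t,y)‖ ≤ 3A₀ ∑_x |η_x||ψ̃_x|`. [folklore] -/
theorem norm_wp_le (hA : D.AmpBounds A₀ A₁ A₂ H₁ H₂) {t : ℝ} (ht : t ∈ Icc 0 D.T) (y : 𝕋³) :
    ‖D.wp t y‖ ≤ ∑ x, 3 * A₀ * (|Jet.eta (D.J x) x t y| * |Jet.psiJ (D.J x) D.s x y|) := by
  unfold Datum.wp
  refine (norm_sum_le _ _).trans (Finset.sum_le_sum fun x _ => ?_)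
  rw [Jet.W, smul_smul, norm_smul, Real.norm_eq_abs, abs_mul, abs_mul]
  have hk := CL22.norm_dirVec_le x
  have ha := hA.a_le x t ht y
  have hA0 := hA.hA₀
  have : 0 ≤ |Jet.eta (D.J x) x t y| * |Jet.psiJ (D.J x) D.s x y| := by positivity
  calc |D.a x t y| * (|Jet.eta (D.J x) x t y| * |Jet.psiJ (D.J x) D.s x y|) * ‖dirVec x‖
      ≤ A₀ * (|Jet.eta (D.J x) x t y| * |Jet.psiJ (D.J x) D.s x y|) * 3 := by gcongr
    _ = _ := by ring

include hB hB1

/-- **Sup bound of `w^{(p)}`**: `‖wp‖ ≤ 3 N A₀ B² κ^{1/2} μ`. [cite: BuckmasterVicol2020, §7.5.4 (7.43)] -/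
theorem norm_wp_le_sup (hA : D.AmpBounds A₀ A₁ A₂ H₁ H₂) {t : ℝ} (ht : t ∈ Icc 0 D.T) (y : 𝕋³) :
    ‖D.wp t y‖ ≤ NN * (3 * A₀ * (B * D.κ ^ (1 / 2 : ℝ) * (B * D.μ))) := by
  refine (norm_wp_le hA ht y).trans (sum_le_NN_mul fun x => ?_)
  have h1 := (hB x t).eta_le y
  have h2 := (hB x t).psiJ_le y
  have hA0 := hA.hA₀
  refine mul_le_mul_of_nonneg_left ?_ (by positivity)
  exact mul_le_mul h1 h2 (abs_nonneg _) (by have := (pos h).2.1; positivity)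

omit hB1 in
/-- **`L¹` bound of `w^{(p)}`**: `∫‖wp‖ ≤ 3 N A₀ B κ^{-1/2} μ⁻¹`. [cite: BuckmasterVicol2020, §7.5.4 (7.41)] -/
theorem integral_norm_wp_le (hA : D.AmpBounds A₀ A₁ A₂ H₁ H₂) {t : ℝ} (ht : t ∈ Icc 0 D.T) :
    ∫ y, ‖D.wp t y‖ ≤ NN * (3 * A₀ * (B * D.κ ^ (-(1 / 2 : ℝ)) * D.μ⁻¹)) := by
  have hcont : ∀ x, Continuous fun y => |Jet.eta (D.J x) x t y| * |Jet.psiJ (D.J x) D.s x y| := fun x =>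
    (Jet.isSmooth_eta (Jvalid h x) x t).continuous.abs.mul (isSmooth_psiJ h x).continuous.abs
  calc ∫ y, ‖D.wp t y‖ ≤ ∫ y, ∑ x, 3 * A₀ * (|Jet.eta (D.J x) x t y| * |Jet.psiJ (D.J x) D.s x y|) :=
        integral_mono (isSmooth_wp h ht).continuous.norm.integrable_unitAddTorus
          ((continuous_finsetSum _ fun x _ => continuous_const.mul (hcont x)).integrable_unitAddTorus) (norm_wp_le hA ht)
    _ = ∑ x, 3 * A₀ * ∫ y, |Jet.eta (D.J x) x t y| * |Jet.psiJ (D.J x) D.s x y| := by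
        rw [integral_finsetSum _ fun x _ =>
          (show Integrable (fun y => 3 * A₀ * (|Jet.eta (D.J x) x t y| * |Jet.psiJ (D.J x) D.s x y|)) volume from
            (continuous_const.mul (hcont x)).integrable_unitAddTorus)]
        exact Finset.sum_congr rfl fun x _ => integral_const_mul _ _
    _ ≤ NN * (3 * A₀ * (B * D.κ ^ (-(1 / 2 : ℝ)) * D.μ⁻¹)) :=
        sum_le_NN_mul fun x => mul_le_mul_of_nonneg_left ((hB x t).int_eta_psi) (by have := hA.hA₀; positivity)

/-! ### The energy of `w^{(p)}`: improved Hölder -/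

omit hB hB1 in
/-- `‖wp(y)‖² = ∑_x F_x(y) |k_x|²` (disjoint supports). [cite: BuckmasterVicol2020, §7.5.2 (7.34)] -/
theorem norm_wp_sq (t : ℝ) (y : 𝕋³) : ‖D.wp t y‖ ^ 2 = ∑ x, D.F x t y * dirNormSq x := by
  rw [EuclideanSpace.norm_sq_eq]
  have h1 : ∀ j, ‖D.wp t y j‖ ^ 2 = (Torus.tensorProd (D.wp t) (D.wp t) y j) j := fun j => by
    rw [Torus.tensorProd, PiLp.smul_apply, smul_eq_mul, Real.norm_eq_abs, sq_abs, sq]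
  simp_rw [h1, tensorProd_wp h t y]
  have e : ∀ j, (∑ x, (D.F x t y * (dir x j : ℝ)) • dirVec x) j = ∑ x, ((D.F x t y * (dir x j : ℝ)) • dirVec x) j :=
    fun j => by simp [Finset.sum_apply]
  simp_rw [e]
  rw [Finset.sum_comm]
  refine Finset.sum_congr rfl fun x _ => ?_
  rw [← sum_sq_dir x, Finset.mul_sum]
  refine Finset.sum_congr rfl fun j _ => ?_
  simp only [PiLp.smul_apply, smul_eq_mul, dirVec]
  ring

omit hB hB1 in
/-- **`η²ψ̃²` is `σ⁻¹`-lattice invariant.** [cite: BuckmasterVicol2020, §7.5.2 ("`W ⊗ W` is `(𝕋/λσ)³`-periodic")] -/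
theorem fastF_latticeInvariant (x : Idx) (t : ℝ) (y : 𝕋³) (κ' : Fin 3 → Fin D.σ) :
    Jet.fastF (D.J x) D.s x t (y + Torus.proj (cellCorner D.σ κ')) = Jet.fastF (D.J x) D.s x t y := by
  have hσ : (D.σ : ℝ) ≠ 0 := by exact_mod_cast h.hσ.ne'
  rw [Jet.fastF_eq, Jet.fastF_eq]
  congr 1
  show Jet.fastBase (D.J x) D.s x t (D.σ • (y + Torus.proj (cellCorner D.σ κ'))) = Jet.fastBase (D.J x) D.s x t (D.σ • y)
  rw [smul_add, Jet.nsmul_proj, cellCorner, smul_smul, mul_inv_cancel₀ hσ, one_smul, Torus.proj_latticeVec, add_zero]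

omit hB hB1 in
/-- **The energy of one jet term**: `∫ hsq_x η²ψ̃² ≤ ∫ hsq_x + 3H₁√3 σ⁻¹` (improved Hölder with `p = 1`). [cite: BuckmasterVicol2020, §7.5.4 (7.40)] -/
theorem integral_hsq_fastF_le (hA : D.AmpBounds A₀ A₁ A₂ H₁ H₂) (x : Idx) {t : ℝ} (ht : t ∈ Icc 0 D.T) :
    ∫ y, JAmp.hsq D.γ₀ D.M x t y * Jet.fastF (D.J x) D.s x t y ≤
      (∫ y, JAmp.hsq D.γ₀ D.M x t y) + 3 * H₁ * (Real.sqrt 3 / D.σ) := by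
  have hσpos : 0 < D.σ := h.hσ
  have hh : Torus.IsSmooth (JAmp.hsq D.γ₀ D.M x t) := (smooth_hsq h x).isSmooth_slice ht
  have hf : Torus.IsSmooth (Jet.fastF (D.J x) D.s x t) := (smooth_fastF h x).isSmooth_slice ht
  have hh0 : ∀ y, 0 ≤ JAmp.hsq D.γ₀ D.M x t y := fun y => (hsq_le h hA x ht y).1
  have hf0 : ∀ y, 0 ≤ Jet.fastF (D.J x) D.s x t y := fun y => by unfold Jet.fastF; positivity
  have hint0 : 0 ≤ ∫ y, JAmp.hsq D.γ₀ D.M x t y := integral_nonneg_of_ae (μ := volume) (Eventually.of_forall hh0)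
  -- the Lipschitz constant of the lift of `hsq`
  have hL : ∀ z z' : E³, |JAmp.hsq D.γ₀ D.M x t (Torus.proj z) - JAmp.hsq D.γ₀ D.M x t (Torus.proj z')| ≤ (3 * H₁) * ‖z - z'‖ := by
    intro z z'
    have hlift : ∀ w, ‖fderiv ℝ (Torus.lift (JAmp.hsq D.γ₀ D.M x t)) w‖ ≤ ∑ _i : Fin 3, H₁ :=
      Torus.norm_fderiv_lift_le_of_norm_partialDeriv_le (hh.isContDiff (by simp)) (M := fun _ => H₁)
        (fun i w => by rw [Real.norm_eq_abs]; exact hA.dh_le x t ht w i)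
    have hdiff : Differentiable ℝ (Torus.lift (JAmp.hsq D.γ₀ D.M x t)) := hh.differentiable (by simp)
    have hmv := Convex.norm_image_sub_le_of_norm_fderiv_le (fun w _ => hdiff.differentiableAt) (fun w _ => hlift w) convex_univ
      (mem_univ z') (mem_univ z)
    rw [Torus.lift_apply, Torus.lift_apply, Real.norm_eq_abs] at hmv
    refine hmv.trans (le_of_eq ?_)
    simp [Finset.sum_const]
  have hIH := Torus.eLpNorm_smul_le_of_latticeInvariant (d := Fin 3) (N := D.σ) (p := 1) hσpos le_rfl (by have := hA.hH₁; positivity)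
    (M := A₀ ^ 2) (f := JAmp.hsq D.γ₀ D.M x t) (g := Jet.fastF (D.J x) D.s x t)
    (fun y => by rw [abs_of_nonneg (hh0 y)]; exact (hsq_le h hA x ht y).2) hL hf.continuous.aestronglyMeasurable
    (fun y κ' => fastF_latticeInvariant h x t y κ')
  -- read the inequality in real numbers
  have e1 : eLpNorm (JAmp.hsq D.γ₀ D.M x t) (ENNReal.ofReal 1) volume = ENNReal.ofReal (∫ y, JAmp.hsq D.γ₀ D.M x t y) := by
    rw [ENNReal.ofReal_one, eLpNorm_one_eq_lintegral_enorm, ← ofReal_integral_norm_eq_lintegral_enorm hh.integrable]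
    congr 1; exact integral_congr_ae (Eventually.of_forall fun y => by simp [abs_of_nonneg (hh0 y)])
  have e2 : eLpNorm (Jet.fastF (D.J x) D.s x t) (ENNReal.ofReal 1) volume = 1 := by
    rw [ENNReal.ofReal_one, eLpNorm_one_eq_lintegral_enorm, ← ofReal_integral_norm_eq_lintegral_enorm hf.integrable]
    have : ∫ y, ‖Jet.fastF (D.J x) D.s x t y‖ = 1 :=
      calc ∫ y, ‖Jet.fastF (D.J x) D.s x t y‖ = ∫ y, Jet.fastF (D.J x) D.s x t y :=
            integral_congr_ae (Eventually.of_forall fun y => by simp [abs_of_nonneg (hf0 y)])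
        _ = 1 := Jet.integral_fastF D.s (Jvalid h x) hd3 x t
    rw [this, ENNReal.ofReal_one]
  have hhf : Torus.IsSmooth (fun y => JAmp.hsq D.γ₀ D.M x t y * Jet.fastF (D.J x) D.s x t y) := hh.mul hf
  have e3 : eLpNorm (fun y => JAmp.hsq D.γ₀ D.M x t y • Jet.fastF (D.J x) D.s x t y) (ENNReal.ofReal 1) volume =
      ENNReal.ofReal (∫ y, JAmp.hsq D.γ₀ D.M x t y * Jet.fastF (D.J x) D.s x t y) := by
    rw [show (fun y => JAmp.hsq D.γ₀ D.M x t y • Jet.fastF (D.J x) D.s x t y) = fun y => JAmp.hsq D.γ₀ D.M x t y * Jet.fastF (D.J x) D.s x t y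
        from rfl, ENNReal.ofReal_one, eLpNorm_one_eq_lintegral_enorm, ← ofReal_integral_norm_eq_lintegral_enorm hhf.integrable]
    congr 1; exact integral_congr_ae (Eventually.of_forall fun y => by simp [abs_of_nonneg (hh0 y), abs_of_nonneg (hf0 y)])
  rw [e1, e2, e3, mul_one, mul_one] at hIH
  have hrhs : ENNReal.ofReal (∫ y, JAmp.hsq D.γ₀ D.M x t y) +
      ENNReal.ofReal ((1 * (A₀ ^ 2) ^ ((1 : ℝ) - 1) * (3 * H₁) * (Real.sqrt (Fintype.card (Fin 3)) / D.σ)) ^ (1 / (1 : ℝ))) =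
      ENNReal.ofReal ((∫ y, JAmp.hsq D.γ₀ D.M x t y) + 3 * H₁ * (Real.sqrt 3 / D.σ)) := by
    rw [← ENNReal.ofReal_add (hint0) (by have := hA.hH₁; positivity)]
    congr 1
    simp
  rw [hrhs] at hIH
  exact (ENNReal.ofReal_le_ofReal_iff (by have := hA.hH₁; have := hint0; positivity)).1 hIH

omit hB hB1 in
/-- **The energy of `w^{(p)}`**: `∫‖wp‖² ≤ 5 ∑_x (∫hsq_x + 3√3 H₁ σ⁻¹) ≤ 5N((2/r₃)(γ₀ + 3∫‖M‖) + 6H₁σ⁻¹)`. [cite: BuckmasterVicol2020, §7.5.4 (7.40)] -/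
theorem integral_norm_wp_sq_le (hA : D.AmpBounds A₀ A₁ A₂ H₁ H₂) {t : ℝ} (ht : t ∈ Icc 0 D.T) :
    ∫ y, ‖D.wp t y‖ ^ 2 ≤ NN * (5 * (2 / radius (Fin 3) * (D.γ₀ + 3 * ∫ y, ‖D.M t y‖) + 3 * H₁ * (Real.sqrt 3 / D.σ))) := by
  have hF : ∀ x, Continuous fun y => D.F x t y := fun x => (isSmooth_F h x ht).continuous
  have hρ := JAmp.integral_rho_le (γ₀ := D.γ₀) (R := D.M) hd3 h.hγ (h.hM.isSmooth_slice ht)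
    ((JAmp.isSmoothSpaceTimeOn_rho h.hγ h.hM).isSmooth_slice ht).continuous
  have hhsq_int : ∀ x, ∫ y, JAmp.hsq D.γ₀ D.M x t y ≤ 2 / radius (Fin 3) * (D.γ₀ + 3 * ∫ y, ‖D.M t y‖) := fun x =>
    (integral_mono ((smooth_hsq h x).isSmooth_slice ht).integrable ((JAmp.isSmoothSpaceTimeOn_rho h.hγ h.hM).isSmooth_slice ht).integrable
      fun y => (JAmp.hsq_bounds hd3 h.hγ x t y).2).trans (by simpa using hρ)
  calc ∫ y, ‖D.wp t y‖ ^ 2 = ∫ y, ∑ x, D.F x t y * dirNormSq x := integral_congr_ae (Eventually.of_forall fun y => norm_wp_sq h t y)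
    _ = ∑ x, dirNormSq x * ∫ y, D.F x t y := by
        rw [integral_finsetSum _ fun x _ =>
          (show Integrable (fun y => D.F x t y * dirNormSq x) volume from ((hF x).mul continuous_const).integrable_unitAddTorus)]
        exact Finset.sum_congr rfl fun x _ => by
          rw [← integral_const_mul]; exact integral_congr_ae (Eventually.of_forall fun y => by simp only; ring)
    _ ≤ ∑ x, 5 * ((∫ y, JAmp.hsq D.γ₀ D.M x t y) + 3 * H₁ * (Real.sqrt 3 / D.σ)) := Finset.sum_le_sum fun x _ => by
        have hFx : ∫ y, D.F x t y = ∫ y, JAmp.hsq D.γ₀ D.M x t y * Jet.fastF (D.J x) D.s x t y :=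
          integral_congr_ae (Eventually.of_forall fun y => by show D.F x t y = _; rw [F, a_sq h])
        rw [hFx]
        have h0 : 0 ≤ ∫ y, JAmp.hsq D.γ₀ D.M x t y * Jet.fastF (D.J x) D.s x t y :=
          integral_nonneg fun y => mul_nonneg (hsq_le h hA x ht y).1 (by unfold Jet.fastF; positivity)
        exact mul_le_mul (dirNormSq_le' x) (integral_hsq_fastF_le h hA x ht) h0 (by norm_num)
    _ ≤ NN * (5 * (2 / radius (Fin 3) * (D.γ₀ + 3 * ∫ y, ‖D.M t y‖) + 3 * H₁ * (Real.sqrt 3 / D.σ))) :=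
        sum_le_NN_mul fun x => by linarith [hhsq_int x]

/-! ## The corrector `w^{(c)} = wpc - wp` -/

omit hB hB1 in
/-- **`wpc - wp = ∑_x (a_x W^{(c)}_x + frameApply_x(η_x ∇a_x))`**. [cite: BuckmasterVicol2020, §7.5.3 (7.35)] -/
theorem wpc_sub_wp {t : ℝ} (ht : t ∈ Icc 0 D.T) (y : 𝕋³) :
    D.wpc t y - D.wp t y = ∑ x, (D.a x t y • Jet.Wc (D.J x) D.s x t y +
      Jet.frameApply (D.J x) D.s x y (Jet.eta (D.J x) x t y • Torus.gradient (D.a x t) y)) := by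
  unfold Datum.wpc Datum.wp
  rw [← Finset.sum_sub_distrib]
  refine Finset.sum_congr rfl fun x _ => ?_
  rw [Jet.tensorDivergence_smul_Om D.s (Jvalid h x) x t (isSmooth_a h x ht) y, smul_add]
  abel

omit h hB hB1 in
/-- `‖v‖ ≤ ∑ᵢ |vᵢ|` on `ℝ³`. [folklore] -/
theorem norm_le_sum_abs_coord (v : E³) : ‖v‖ ≤ ∑ i, |v i| := by
  conv_lhs => rw [← (EuclideanSpace.basisFun (Fin 3) ℝ).sum_repr v]
  refine (norm_sum_le _ _).trans (Finset.sum_le_sum fun i _ => ?_)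
  rw [norm_smul, EuclideanSpace.basisFun_apply, PiLp.norm_single, norm_one, mul_one, EuclideanSpace.basisFun_repr,
    Real.norm_eq_abs]

omit h hB hB1 in
/-- `‖∇φ‖ ≤ ∑ₗ |∂ₗφ|`. [folklore] -/
theorem norm_gradient_le {φ : 𝕋³ → ℝ} (hφ : Torus.IsContDiff 1 φ) (y : 𝕋³) : ‖Torus.gradient φ y‖ ≤ ∑ l, |Torus.partialDeriv l φ y| := by
  calc ‖Torus.gradient φ y‖ ≤ ∑ l, |Torus.gradient φ y l| := norm_le_sum_abs_coord _
    _ = ∑ l, |Torus.partialDeriv l φ y| := Finset.sum_congr rfl fun l _ => by rw [Torus.gradient_apply hφ]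

omit h hB hB1 in
/-- **Size of the frame action**: `‖frameApply(v)‖ ≤ 12 ‖v‖ ∑ⱼ |∂ⱼφ̃|`. [folklore] -/
theorem norm_frameApply_le {J : Jet.Params} {s : Idx → 𝕋³} (x : Idx) (hφ : Torus.IsSmooth (Jet.phiJ J s x)) (y : 𝕋³) (v : E³) :
    ‖Jet.frameApply J s x y v‖ ≤ 12 * ‖v‖ * ∑ j, |Torus.partialDeriv j (Jet.phiJ J s x) y| := by
  set S := ∑ j, |Torus.partialDeriv j (Jet.phiJ J s x) y| with hS
  have hS0 : 0 ≤ S := Finset.sum_nonneg fun _ _ => abs_nonneg _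
  have hv : ∀ j, |v j| ≤ ‖v‖ := fun j => by rw [← Real.norm_eq_abs]; exact PiLp.norm_apply_le v j
  have hvn : 0 ≤ ‖v‖ := norm_nonneg v
  have h1 : |∑ j, Torus.partialDeriv j (Jet.phiJ J s x) y * v j| ≤ S * ‖v‖ := by
    calc |∑ j, Torus.partialDeriv j (Jet.phiJ J s x) y * v j| ≤ ∑ j, |Torus.partialDeriv j (Jet.phiJ J s x) y * v j| := Finset.abs_sum_le_sum_abs _ _
      _ ≤ ∑ j, |Torus.partialDeriv j (Jet.phiJ J s x) y| * ‖v‖ := Finset.sum_le_sum fun j _ => by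
          rw [abs_mul]; exact mul_le_mul_of_nonneg_left (hv j) (abs_nonneg _)
      _ = S * ‖v‖ := by rw [Finset.sum_mul]
  have h2 : |∑ j, ((dir x j : ℤ) : ℝ) * v j| ≤ 9 * ‖v‖ := by
    calc |∑ j, ((dir x j : ℤ) : ℝ) * v j| ≤ ∑ j, |((dir x j : ℤ) : ℝ) * v j| := Finset.abs_sum_le_sum_abs _ _
      _ ≤ ∑ _j : Fin 3, 3 * ‖v‖ := Finset.sum_le_sum fun j _ => by
          rw [abs_mul]; exact mul_le_mul (abs_dir_le x j) (hv j) (abs_nonneg _) (by norm_num)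
      _ = 9 * ‖v‖ := by simp only [Finset.sum_const, Finset.card_univ, Fintype.card_fin, nsmul_eq_mul, Nat.cast_ofNat]; ring
  have hg : ‖Torus.gradient (Jet.phiJ J s x) y‖ ≤ S := norm_gradient_le (hφ.isContDiff (by simp)) y
  unfold Jet.frameApply
  calc ‖(∑ j, Torus.partialDeriv j (Jet.phiJ J s x) y * v j) • dirVec x - (∑ j, ((dir x j : ℤ) : ℝ) * v j) • Torus.gradient (Jet.phiJ J s x) y‖
      ≤ ‖(∑ j, Torus.partialDeriv j (Jet.phiJ J s x) y * v j) • dirVec x‖ + ‖(∑ j, ((dir x j : ℤ) : ℝ) * v j) • Torus.gradient (Jet.phiJ J s x) y‖ :=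
        norm_sub_le _ _
    _ ≤ S * ‖v‖ * 3 + 9 * ‖v‖ * S := by
        rw [norm_smul, norm_smul, Real.norm_eq_abs, Real.norm_eq_abs]
        exact add_le_add (mul_le_mul h1 (CL22.norm_dirVec_le x) (norm_nonneg _) (by positivity))
          (mul_le_mul h2 hg (norm_nonneg _) (by positivity))
    _ = 12 * ‖v‖ * S := by ring

omit hB hB1 in
/-- **Pointwise majorant of `w^{(c)}`**:
`‖wpc - wp‖ ≤ ∑_x ∑_j (5σA₀ |η'_x ∂ⱼφ̃_x| + 36A₁ |η_x ∂ⱼφ̃_x|)`. [cite: BuckmasterVicol2020, §7.5.4 (7.44)] -/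
theorem norm_wc_le (hA : D.AmpBounds A₀ A₁ A₂ H₁ H₂) {t : ℝ} (ht : t ∈ Icc 0 D.T) (y : 𝕋³) :
    ‖D.wpc t y - D.wp t y‖ ≤ ∑ x, ∑ j, (5 * D.σ * A₀ * |Jet.etaD (D.J x) x t y * Torus.partialDeriv j (Jet.phiJ (D.J x) D.s x) y| +
      36 * A₁ * |Jet.eta (D.J x) x t y * Torus.partialDeriv j (Jet.phiJ (D.J x) D.s x) y|) := by
  rw [wpc_sub_wp h ht]
  refine (norm_sum_le _ _).trans (Finset.sum_le_sum fun x _ => ?_)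
  have hJ := Jvalid h x
  have hφ := isSmooth_phiJ h x
  set S := ∑ j, |Torus.partialDeriv j (Jet.phiJ (D.J x) D.s x) y| with hS
  have hS0 : 0 ≤ S := Finset.sum_nonneg fun _ _ => abs_nonneg _
  have hA0 := hA.hA₀; have hA1 := hA.hA₁
  have ha := hA.a_le x t ht y
  -- the `a Wc` term
  have hWc : ‖D.a x t y • Jet.Wc (D.J x) D.s x t y‖ ≤ 5 * D.σ * A₀ * (|Jet.etaD (D.J x) x t y| * S) := by
    rw [Jet.Wc, norm_smul, norm_smul, Real.norm_eq_abs, Real.norm_eq_abs, abs_neg, Jet.dirD_eta hJ, sum_sq_dir]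
    have hg := norm_gradient_le (hφ.isContDiff (by simp)) y
    have hk : dirNormSq x ≤ 5 := dirNormSq_le' x
    have hσ : ((D.J x).σ : ℝ) = D.σ := rfl
    have hσ0 : (0 : ℝ) ≤ D.σ := (pos h).2.2.1.le
    have hd0 : 0 ≤ dirNormSq x := (dirNormSq_pos x).le
    rw [hσ, abs_mul, abs_mul, abs_of_nonneg hσ0, abs_of_nonneg hd0]
    calc |D.a x t y| * (↑D.σ * dirNormSq x * |Jet.etaD (D.J x) x t y| * ‖Torus.gradient (Jet.phiJ (D.J x) D.s x) y‖)
        ≤ A₀ * (↑D.σ * 5 * |Jet.etaD (D.J x) x t y| * S) := by gcongr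
      _ = 5 * D.σ * A₀ * (|Jet.etaD (D.J x) x t y| * S) := by ring
  -- the frame term
  have hv : ‖Jet.eta (D.J x) x t y • Torus.gradient (D.a x t) y‖ ≤ |Jet.eta (D.J x) x t y| * (3 * A₁) := by
    rw [norm_smul, Real.norm_eq_abs]
    refine mul_le_mul_of_nonneg_left ?_ (abs_nonneg _)
    calc ‖Torus.gradient (D.a x t) y‖ ≤ ∑ l, |Torus.partialDeriv l (D.a x t) y| := norm_gradient_le ((isSmooth_a h x ht).isContDiff (by simp)) y
      _ ≤ ∑ _l : Fin 3, A₁ := Finset.sum_le_sum fun l _ => hA.da_le x t ht y l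
      _ = 3 * A₁ := by simp only [Finset.sum_const, Finset.card_univ, Fintype.card_fin, nsmul_eq_mul, Nat.cast_ofNat]
  have hfr := norm_frameApply_le x hφ y (Jet.eta (D.J x) x t y • Torus.gradient (D.a x t) y)
  calc ‖D.a x t y • Jet.Wc (D.J x) D.s x t y + Jet.frameApply (D.J x) D.s x y (Jet.eta (D.J x) x t y • Torus.gradient (D.a x t) y)‖
      ≤ 5 * D.σ * A₀ * (|Jet.etaD (D.J x) x t y| * S) + 12 * (|Jet.eta (D.J x) x t y| * (3 * A₁)) * S := by
        refine (norm_add_le _ _).trans (add_le_add hWc (hfr.trans ?_))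
        gcongr
    _ = ∑ j, (5 * D.σ * A₀ * |Jet.etaD (D.J x) x t y * Torus.partialDeriv j (Jet.phiJ (D.J x) D.s x) y| +
        36 * A₁ * |Jet.eta (D.J x) x t y * Torus.partialDeriv j (Jet.phiJ (D.J x) D.s x) y|) := by
        rw [hS, Finset.mul_sum, Finset.mul_sum, Finset.mul_sum, ← Finset.sum_add_distrib]
        refine Finset.sum_congr rfl fun j _ => ?_
        rw [abs_mul, abs_mul]; ring

/-- **Sup bound of `w^{(c)}`**: `‖wpc - wp‖ ≤ 3N B² (5A₀κ^{3/2} + 36A₁κ^{1/2}σ⁻¹)`. [cite: BuckmasterVicol2020, §7.5.4 (7.44)] -/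
theorem norm_wc_le_sup (hA : D.AmpBounds A₀ A₁ A₂ H₁ H₂) {t : ℝ} (ht : t ∈ Icc 0 D.T) (y : 𝕋³) :
    ‖D.wpc t y - D.wp t y‖ ≤ NN * (3 * (B ^ 2 * (5 * A₀ * D.κ ^ (3 / 2 : ℝ) + 36 * A₁ * D.κ ^ (1 / 2 : ℝ) * (D.σ : ℝ)⁻¹))) := by
  obtain ⟨hμ, hκ, hσ, hmup, -⟩ := pos h
  have hA0 := hA.hA₀; have hA1 := hA.hA₁
  refine (norm_wc_le h hA ht y).trans (sum_le_NN_mul fun x => ?_)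
  calc ∑ j, (5 * D.σ * A₀ * |Jet.etaD (D.J x) x t y * Torus.partialDeriv j (Jet.phiJ (D.J x) D.s x) y| +
        36 * A₁ * |Jet.eta (D.J x) x t y * Torus.partialDeriv j (Jet.phiJ (D.J x) D.s x) y|)
      ≤ ∑ _j : Fin 3, (5 * D.σ * A₀ * (B * D.κ ^ (3 / 2 : ℝ) * (B * (D.σ : ℝ)⁻¹)) + 36 * A₁ * (B * D.κ ^ (1 / 2 : ℝ) * (B * (D.σ : ℝ)⁻¹))) :=
        Finset.sum_le_sum fun j _ => by
          rw [abs_mul, abs_mul]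
          exact add_le_add
            (mul_le_mul_of_nonneg_left (mul_le_mul ((hB x t).etaD_le y) ((hB x t).partialDeriv_phiJ_le j y) (abs_nonneg _)
              (by positivity)) (by positivity))
            (mul_le_mul_of_nonneg_left (mul_le_mul ((hB x t).eta_le y) ((hB x t).partialDeriv_phiJ_le j y) (abs_nonneg _)
              (by positivity)) (by positivity))
    _ = 3 * (B ^ 2 * (5 * A₀ * D.κ ^ (3 / 2 : ℝ) + 36 * A₁ * D.κ ^ (1 / 2 : ℝ) * (D.σ : ℝ)⁻¹)) := by
        simp only [Finset.sum_const, Finset.card_univ, Fintype.card_fin, nsmul_eq_mul, Nat.cast_ofNat]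
        rw [show (5 : ℝ) * D.σ * A₀ * (B * D.κ ^ (3 / 2 : ℝ) * (B * (D.σ : ℝ)⁻¹)) =
          5 * A₀ * B ^ 2 * D.κ ^ (3 / 2 : ℝ) * ((D.σ : ℝ) * (D.σ : ℝ)⁻¹) by ring, mul_inv_cancel₀ hσ.ne']
        ring

omit hB1 in
/-- **`L¹` bound of `w^{(c)}`**: `∫‖wpc - wp‖ ≤ 3N B (5A₀κ^{1/2}μ⁻² + 36A₁κ^{-1/2}σ⁻¹μ⁻²)`. [cite: BuckmasterVicol2020, §7.5.4 (7.44)] -/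
theorem integral_norm_wc_le (hA : D.AmpBounds A₀ A₁ A₂ H₁ H₂) {t : ℝ} (ht : t ∈ Icc 0 D.T) :
    ∫ y, ‖D.wpc t y - D.wp t y‖ ≤ NN * (3 * (B * (5 * A₀ * (D.κ ^ (1 / 2 : ℝ) * D.μ ^ (-(2 : ℝ))) +
      36 * A₁ * (D.κ ^ (-(1 / 2 : ℝ)) * (D.σ : ℝ)⁻¹ * D.μ ^ (-(2 : ℝ)))))) := by
  obtain ⟨hμ, hκ, hσ, hmup, -⟩ := pos h
  have hA0 := hA.hA₀; have hA1 := hA.hA₁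
  have c1 : ∀ x j, Continuous fun y => Jet.etaD (D.J x) x t y * Torus.partialDeriv j (Jet.phiJ (D.J x) D.s x) y := fun x j =>
    (Jet.isSmooth_etaD (Jvalid h x) x t).continuous.mul ((isSmooth_phiJ h x).partialDeriv j).continuous
  have c2 : ∀ x j, Continuous fun y => Jet.eta (D.J x) x t y * Torus.partialDeriv j (Jet.phiJ (D.J x) D.s x) y := fun x j =>
    (Jet.isSmooth_eta (Jvalid h x) x t).continuous.mul ((isSmooth_phiJ h x).partialDeriv j).continuous
  have cterm : ∀ x j, Continuous fun y => 5 * D.σ * A₀ * |Jet.etaD (D.J x) x t y * Torus.partialDeriv j (Jet.phiJ (D.J x) D.s x) y| +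
      36 * A₁ * |Jet.eta (D.J x) x t y * Torus.partialDeriv j (Jet.phiJ (D.J x) D.s x) y| := fun x j =>
    (continuous_const.mul (c1 x j).abs).add (continuous_const.mul (c2 x j).abs)
  have I1 : ∀ x j, ∫ y, |Jet.etaD (D.J x) x t y * Torus.partialDeriv j (Jet.phiJ (D.J x) D.s x) y| ≤
      B * D.κ ^ (1 / 2 : ℝ) * (D.σ : ℝ)⁻¹ * D.μ ^ (-(2 : ℝ)) := fun x j => by
    have hI := (hB x t).int_etaD_dphi j
    refine le_trans (le_of_eq (integral_congr_ae (Eventually.of_forall fun y => abs_mul _ _))) hI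
  have I2 : ∀ x j, ∫ y, |Jet.eta (D.J x) x t y * Torus.partialDeriv j (Jet.phiJ (D.J x) D.s x) y| ≤
      B * D.κ ^ (-(1 / 2 : ℝ)) * (D.σ : ℝ)⁻¹ * D.μ ^ (-(2 : ℝ)) := fun x j => by
    have hI := (hB x t).int_eta_dphi j
    refine le_trans (le_of_eq (integral_congr_ae (Eventually.of_forall fun y => abs_mul _ _))) hI
  calc ∫ y, ‖D.wpc t y - D.wp t y‖
      ≤ ∫ y, ∑ x, ∑ j, (5 * D.σ * A₀ * |Jet.etaD (D.J x) x t y * Torus.partialDeriv j (Jet.phiJ (D.J x) D.s x) y| +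
          36 * A₁ * |Jet.eta (D.J x) x t y * Torus.partialDeriv j (Jet.phiJ (D.J x) D.s x) y|) :=
        integral_mono (((smooth_wpc h).isSmooth_slice ht).sub (isSmooth_wp h ht)).continuous.norm.integrable_unitAddTorus
          ((continuous_finsetSum _ fun x _ => continuous_finsetSum _ fun j _ => cterm x j).integrable_unitAddTorus) (norm_wc_le h hA ht)
    _ = ∑ x, ∑ j, (5 * D.σ * A₀ * (∫ y, |Jet.etaD (D.J x) x t y * Torus.partialDeriv j (Jet.phiJ (D.J x) D.s x) y|) +
          36 * A₁ * (∫ y, |Jet.eta (D.J x) x t y * Torus.partialDeriv j (Jet.phiJ (D.J x) D.s x) y|)) := by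
        rw [integral_finsetSum _ fun x _ => (show Integrable (fun y => ∑ j, (5 * D.σ * A₀ *
            |Jet.etaD (D.J x) x t y * Torus.partialDeriv j (Jet.phiJ (D.J x) D.s x) y| +
            36 * A₁ * |Jet.eta (D.J x) x t y * Torus.partialDeriv j (Jet.phiJ (D.J x) D.s x) y|)) volume from
            (continuous_finsetSum _ fun j _ => cterm x j).integrable_unitAddTorus)]
        refine Finset.sum_congr rfl fun x _ => ?_
        rw [integral_finsetSum _ fun j _ => (show Integrable (fun y => 5 * D.σ * A₀ *
            |Jet.etaD (D.J x) x t y * Torus.partialDeriv j (Jet.phiJ (D.J x) D.s x) y| +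
            36 * A₁ * |Jet.eta (D.J x) x t y * Torus.partialDeriv j (Jet.phiJ (D.J x) D.s x) y|) volume from
            (cterm x j).integrable_unitAddTorus)]
        refine Finset.sum_congr rfl fun j _ => ?_
        rw [integral_add ((c1 x j).abs.integrable_unitAddTorus.const_mul _) ((c2 x j).abs.integrable_unitAddTorus.const_mul _),
          integral_const_mul, integral_const_mul]
    _ ≤ NN * (3 * (B * (5 * A₀ * (D.κ ^ (1 / 2 : ℝ) * D.μ ^ (-(2 : ℝ))) +
          36 * A₁ * (D.κ ^ (-(1 / 2 : ℝ)) * (D.σ : ℝ)⁻¹ * D.μ ^ (-(2 : ℝ)))))) := sum_le_NN_mul fun x => by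
        calc ∑ j, (5 * D.σ * A₀ * (∫ y, |Jet.etaD (D.J x) x t y * Torus.partialDeriv j (Jet.phiJ (D.J x) D.s x) y|) +
              36 * A₁ * (∫ y, |Jet.eta (D.J x) x t y * Torus.partialDeriv j (Jet.phiJ (D.J x) D.s x) y|))
            ≤ ∑ _j : Fin 3, (5 * D.σ * A₀ * (B * D.κ ^ (1 / 2 : ℝ) * (D.σ : ℝ)⁻¹ * D.μ ^ (-(2 : ℝ))) +
              36 * A₁ * (B * D.κ ^ (-(1 / 2 : ℝ)) * (D.σ : ℝ)⁻¹ * D.μ ^ (-(2 : ℝ)))) := Finset.sum_le_sum fun j _ =>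
              add_le_add (mul_le_mul_of_nonneg_left (I1 x j) (by positivity)) (mul_le_mul_of_nonneg_left (I2 x j) (by positivity))
          _ = 3 * (B * (5 * A₀ * (D.κ ^ (1 / 2 : ℝ) * D.μ ^ (-(2 : ℝ))) +
              36 * A₁ * (D.κ ^ (-(1 / 2 : ℝ)) * (D.σ : ℝ)⁻¹ * D.μ ^ (-(2 : ℝ))))) := by
              simp only [Finset.sum_const, Finset.card_univ, Fintype.card_fin, nsmul_eq_mul, Nat.cast_ofNat]
              rw [show (5 : ℝ) * D.σ * A₀ * (B * D.κ ^ (1 / 2 : ℝ) * (D.σ : ℝ)⁻¹ * D.μ ^ (-(2 : ℝ))) =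
                5 * A₀ * B * D.κ ^ (1 / 2 : ℝ) * D.μ ^ (-(2 : ℝ)) * ((D.σ : ℝ) * (D.σ : ℝ)⁻¹) by ring, mul_inv_cancel₀ hσ.ne']
              ring

/-! ## The non-gradient temporal corrector `X` -/

/-- `0 ≤ F_x ≤ A₀² B⁴ κ μ²`, `∫F_x ≤ A₀²`. [folklore] -/
theorem F_bounds (hA : D.AmpBounds A₀ A₁ A₂ H₁ H₂) (x : Idx) {t : ℝ} (ht : t ∈ Icc 0 D.T) :
    (∀ y, 0 ≤ D.F x t y) ∧ (∀ y, D.F x t y ≤ A₀ ^ 2 * (B ^ 4 * D.κ * D.μ ^ 2)) ∧ (∫ y, D.F x t y ≤ A₀ ^ 2) ∧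
      ∫ y, D.F x t y ^ 2 ≤ A₀ ^ 4 * (B * D.κ * D.μ ^ 2) := by
  obtain ⟨hμ, hκ, hσ, hmup, hμ1, hκ1, -⟩ := pos h
  have hA0 := hA.hA₀
  have hB0 : 0 ≤ B := by linarith
  have hf0 : ∀ y, 0 ≤ Jet.fastF (D.J x) D.s x t y := fun y => by unfold Jet.fastF; positivity
  have hF : ∀ y, D.F x t y = JAmp.hsq D.γ₀ D.M x t y * Jet.fastF (D.J x) D.s x t y := fun y => by rw [F, a_sq h]
  have hhs := fun y => hsq_le h hA x ht y
  have hfast : ∀ y, Jet.fastF (D.J x) D.s x t y ≤ B ^ 4 * D.κ * D.μ ^ 2 := fun y => by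
    have h1 := (hB x t).eta_le y
    have h2 := (hB x t).psiJ_le y
    have e1 : Jet.fastF (D.J x) D.s x t y = |Jet.eta (D.J x) x t y| ^ 2 * |Jet.psiJ (D.J x) D.s x y| ^ 2 := by
      rw [Jet.fastF, sq_abs, sq_abs]
    rw [e1]
    have hκ' : (B * (D.J x).κ ^ (1 / 2 : ℝ)) ^ 2 = B ^ 2 * D.κ := by
      have : ((D.J x).κ ^ (1 / 2 : ℝ)) ^ 2 = D.κ := by
        show (D.κ ^ (1 / 2 : ℝ)) ^ 2 = D.κ
        rw [← Real.rpow_natCast, ← Real.rpow_mul hκ.le]; norm_num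
      rw [mul_pow, this]
    calc |Jet.eta (D.J x) x t y| ^ 2 * |Jet.psiJ (D.J x) D.s x y| ^ 2 ≤ (B * (D.J x).κ ^ (1 / 2 : ℝ)) ^ 2 * (B * (D.J x).μ) ^ 2 :=
          mul_le_mul (pow_le_pow_left₀ (abs_nonneg _) h1 2) (pow_le_pow_left₀ (abs_nonneg _) h2 2) (by positivity) (by positivity)
      _ = B ^ 4 * D.κ * D.μ ^ 2 := by rw [hκ']; show B ^ 2 * D.κ * (B * D.μ) ^ 2 = _; ring
  refine ⟨fun y => by rw [hF]; exact mul_nonneg (hhs y).1 (hf0 y), fun y => ?_, ?_, ?_⟩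
  · rw [hF]; exact mul_le_mul (hhs y).2 (hfast y) (hf0 y) (by positivity)
  · calc ∫ y, D.F x t y = ∫ y, JAmp.hsq D.γ₀ D.M x t y * Jet.fastF (D.J x) D.s x t y := integral_congr_ae (Eventually.of_forall hF)
      _ ≤ ∫ y, A₀ ^ 2 * Jet.fastF (D.J x) D.s x t y := by
          have hi : Torus.IsSmooth (fun y => JAmp.hsq D.γ₀ D.M x t y * Jet.fastF (D.J x) D.s x t y) :=
            ((smooth_hsq h x).isSmooth_slice ht).mul ((smooth_fastF h x).isSmooth_slice ht)
          exact integral_mono hi.integrable (((smooth_fastF h x).isSmooth_slice ht).integrable.const_mul _)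
            fun y => mul_le_mul_of_nonneg_right (hhs y).2 (hf0 y)
      _ = A₀ ^ 2 := by rw [integral_const_mul, Jet.integral_fastF D.s (Jvalid h x) hd3 x t, mul_one]
  · calc ∫ y, D.F x t y ^ 2 ≤ ∫ y, A₀ ^ 4 * Jet.fastF (D.J x) D.s x t y ^ 2 := by
          refine integral_mono ((isSmooth_F h x ht).continuous.pow 2).integrable_unitAddTorus
            ((((smooth_fastF h x).isSmooth_slice ht).continuous.pow 2).integrable_unitAddTorus.const_mul _) fun y => ?_
          rw [hF, mul_pow, show A₀ ^ 4 = (A₀ ^ 2) ^ 2 by ring]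
          exact mul_le_mul_of_nonneg_right (pow_le_pow_left₀ (hhs y).1 (hhs y).2 2) (by positivity)
      _ ≤ A₀ ^ 4 * (B * D.κ * D.μ ^ 2) := by rw [integral_const_mul]; exact mul_le_mul_of_nonneg_left (hB x t).int_fastF_sq (by positivity)

/-- **Sup bound of `X`**: `‖X‖ ≤ 6 N μ'⁻¹ A₀² B⁴ κ μ²`. [cite: BuckmasterVicol2020, §7.5.4 (7.45)] -/
theorem norm_X_le_sup (hA : D.AmpBounds A₀ A₁ A₂ H₁ H₂) {t : ℝ} (ht : t ∈ Icc 0 D.T) (y : 𝕋³) :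
    ‖D.X t y‖ ≤ NN * (6 * D.mup⁻¹ * A₀ ^ 2 * (B ^ 4 * D.κ * D.μ ^ 2)) := by
  obtain ⟨hμ, hκ, hσ, hmup, hμ1, hκ1, -⟩ := pos h
  have hA0 := hA.hA₀
  have hB4 : 1 ≤ B ^ 4 * D.κ * D.μ ^ 2 := by
    have : 1 ≤ B ^ 4 := one_le_pow₀ hB1
    nlinarith [mul_le_mul this hκ1 zero_le_one (by positivity), mul_le_mul (le_refl (B ^ 4 * D.κ)) (one_le_pow₀ hμ1 : (1:ℝ) ≤ D.μ ^ 2)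
      zero_le_one (by positivity)]
  unfold Datum.X
  rw [norm_neg]
  refine (norm_sum_le _ _).trans (sum_le_NN_mul fun x => ?_)
  obtain ⟨hF0, hFsup, hFint, -⟩ := F_bounds h hB hB1 hA x ht
  rw [norm_smul, Real.norm_eq_abs, abs_mul, abs_of_pos (inv_pos.2 hmup)]
  have h1 : |D.F x t y - ∫ z, D.F x t z| ≤ 2 * (A₀ ^ 2 * (B ^ 4 * D.κ * D.μ ^ 2)) := by
    rw [abs_le]
    have hi0 : 0 ≤ ∫ z, D.F x t z := integral_nonneg_of_ae (μ := volume) (Eventually.of_forall hF0)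
    have hi1 : ∫ z, D.F x t z ≤ A₀ ^ 2 * (B ^ 4 * D.κ * D.μ ^ 2) := hFint.trans (by nlinarith [sq_nonneg A₀])
    constructor <;> nlinarith [hF0 y, hFsup y]
  calc D.mup⁻¹ * |D.F x t y - ∫ z, D.F x t z| * ‖dirVec x‖ ≤ D.mup⁻¹ * (2 * (A₀ ^ 2 * (B ^ 4 * D.κ * D.μ ^ 2))) * 3 := by
        gcongr; exact CL22.norm_dirVec_le x
    _ = 6 * D.mup⁻¹ * A₀ ^ 2 * (B ^ 4 * D.κ * D.μ ^ 2) := by ring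

/-- **Energy of `X`**: `∫‖X‖² ≤ 9 N² μ'⁻² A₀⁴ B κ μ²`. [cite: BuckmasterVicol2020, §7.5.4 (7.45)] -/
theorem integral_norm_X_sq_le (hA : D.AmpBounds A₀ A₁ A₂ H₁ H₂) {t : ℝ} (ht : t ∈ Icc 0 D.T) :
    ∫ y, ‖D.X t y‖ ^ 2 ≤ NN * (NN * (9 * (D.mup⁻¹) ^ 2 * (A₀ ^ 4 * (B * D.κ * D.μ ^ 2)))) := by
  obtain ⟨hμ, hκ, hσ, hmup, -⟩ := pos h
  have hA0 := hA.hA₀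
  have hcF : ∀ x, Continuous fun y => D.F x t y := fun x => (isSmooth_F h x ht).continuous
  -- pointwise: `‖X‖² ≤ N ∑_x 9 μ'⁻² (F - ∫F)²`
  have hpt : ∀ y, ‖D.X t y‖ ^ 2 ≤ NN * ∑ x, 9 * (D.mup⁻¹) ^ 2 * (D.F x t y - ∫ z, D.F x t z) ^ 2 := by
    intro y
    have h1 : ‖D.X t y‖ ≤ ∑ x, 3 * D.mup⁻¹ * |D.F x t y - ∫ z, D.F x t z| := by
      unfold Datum.X; rw [norm_neg]
      refine (norm_sum_le _ _).trans (Finset.sum_le_sum fun x _ => ?_)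
      rw [norm_smul, Real.norm_eq_abs, abs_mul, abs_of_pos (inv_pos.2 hmup)]
      calc D.mup⁻¹ * |D.F x t y - ∫ z, D.F x t z| * ‖dirVec x‖ ≤ D.mup⁻¹ * |D.F x t y - ∫ z, D.F x t z| * 3 := by
            gcongr; exact CL22.norm_dirVec_le x
        _ = _ := by ring
    calc ‖D.X t y‖ ^ 2 ≤ (∑ x, 3 * D.mup⁻¹ * |D.F x t y - ∫ z, D.F x t z|) ^ 2 := pow_le_pow_left₀ (norm_nonneg _) h1 2
      _ ≤ NN * ∑ x, (3 * D.mup⁻¹ * |D.F x t y - ∫ z, D.F x t z|) ^ 2 := sq_sum_le _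
      _ = NN * ∑ x, 9 * (D.mup⁻¹) ^ 2 * (D.F x t y - ∫ z, D.F x t z) ^ 2 := by
          congr 1; refine Finset.sum_congr rfl fun x _ => ?_; rw [mul_pow, mul_pow, sq_abs]; ring
  -- the variance bound `∫ (F - ∫F)² ≤ ∫ F²`
  have hvar : ∀ x, ∫ y, (D.F x t y - ∫ z, D.F x t z) ^ 2 ≤ ∫ y, D.F x t y ^ 2 := by
    intro x
    set m := ∫ z, D.F x t z
    have hi : Integrable (fun y => D.F x t y) volume := (hcF x).integrable_unitAddTorus
    have hi2 : Integrable (fun y => D.F x t y ^ 2) volume := ((hcF x).pow 2).integrable_unitAddTorus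
    have e : ∀ y, (D.F x t y - m) ^ 2 = D.F x t y ^ 2 - 2 * m * D.F x t y + m ^ 2 := fun y => by ring
    simp_rw [e]
    have i3 : Integrable (fun y => D.F x t y ^ 2 - 2 * m * D.F x t y) volume := hi2.sub (hi.const_mul _)
    rw [integral_add i3 (integrable_const _), integral_sub hi2 (hi.const_mul _), integral_const_mul,
      MeasureTheory.integral_const, smul_eq_mul, probReal_univ, one_mul]
    nlinarith [sq_nonneg m]
  calc ∫ y, ‖D.X t y‖ ^ 2 ≤ ∫ y, NN * ∑ x, 9 * (D.mup⁻¹) ^ 2 * (D.F x t y - ∫ z, D.F x t z) ^ 2 :=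
        integral_mono (((smooth_X h).isSmooth_slice ht).continuous.norm.pow 2).integrable_unitAddTorus
          ((continuous_const.mul (continuous_finsetSum _ fun x _ => continuous_const.mul (((hcF x).sub continuous_const).pow 2))).integrable_unitAddTorus)
          hpt
    _ = NN * ∑ x, 9 * (D.mup⁻¹) ^ 2 * ∫ y, (D.F x t y - ∫ z, D.F x t z) ^ 2 := by
        rw [integral_const_mul, integral_finsetSum _ fun x _ =>
          (show Integrable (fun y => 9 * (D.mup⁻¹) ^ 2 * (D.F x t y - ∫ z, D.F x t z) ^ 2) volume from
            (continuous_const.mul (((hcF x).sub continuous_const).pow 2)).integrable_unitAddTorus)]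
        congr 1; exact Finset.sum_congr rfl fun x _ => integral_const_mul _ _
    _ ≤ NN * (NN * (9 * (D.mup⁻¹) ^ 2 * (A₀ ^ 4 * (B * D.κ * D.μ ^ 2)))) := by
        refine mul_le_mul_of_nonneg_left (sum_le_NN_mul fun x => ?_) (by linarith [one_le_NN])
        exact mul_le_mul_of_nonneg_left ((hvar x).trans (F_bounds h hB hB1 hA x ht).2.2.2) (by positivity)

/-! ## The gradient part `∇ζ` -/

/-- The potentials `H_j = ∑_x μ'⁻¹ (k_x)_j F_x`, so that `G = ∑_j ∂_j H_j`. [folklore] -/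
def Hfun (D : Datum) (j : Fin 3) (t : ℝ) (y : 𝕋³) : ℝ := ∑ x, (D.mup⁻¹ * (dir x j : ℝ)) * D.F x t y

omit hB hB1 in
/-- `H_j` is smooth. [folklore] -/
theorem isSmooth_Hfun (j : Fin 3) {t : ℝ} (ht : t ∈ Icc 0 D.T) : Torus.IsSmooth (D.Hfun j t) :=
  Torus.isSmooth_finset_sum _ fun x _ => (Torus.isSmooth_const _).mul (isSmooth_F h x ht)

omit hB hB1 in
/-- `G = ∑_j ∂_j H_j`. [folklore] -/
theorem G_eq_sum_partialDeriv_Hfun {t : ℝ} (ht : t ∈ Icc 0 D.T) (y : 𝕋³) : D.G t y = ∑ j, Torus.partialDeriv j (D.Hfun j t) y := by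
  simp only [Datum.G, dirD, Finset.mul_sum]
  rw [Finset.sum_comm]
  refine Finset.sum_congr rfl fun j _ => ?_
  have hcx : ∀ x, Torus.IsSmooth (fun y => D.mup⁻¹ * (dir x j : ℝ) * D.F x t y) := fun x => (Torus.isSmooth_const _).mul (isSmooth_F h x ht)
  rw [show D.Hfun j t = fun y => ∑ x ∈ Finset.univ, D.mup⁻¹ * (dir x j : ℝ) * D.F x t y from rfl,
    Torus.partialDeriv_finset_sum Finset.univ fun x _ => (hcx x).isContDiff (by simp)]
  refine Finset.sum_congr rfl fun x _ => ?_
  rw [show (fun y => D.mup⁻¹ * (dir x j : ℝ) * D.F x t y) = fun y => (fun _ => D.mup⁻¹ * (dir x j : ℝ)) y * D.F x t y from rfl,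
    Torus.partialDeriv_mul (Torus.isContDiff_const _) ((isSmooth_F h x ht).isContDiff (by simp)), Torus.partialDeriv_const_apply]
  ring

omit hB hB1 in
/-- **`∂ᵢζ = ∑_j ∂ᵢ∂ⱼ Δ⁻¹H_j`**. [folklore] -/
theorem partialDeriv_zeta {t : ℝ} (ht : t ∈ Icc 0 D.T) (i : Fin 3) (y : 𝕋³) :
    Torus.partialDeriv i (D.zeta t) y = ∑ j, Torus.partialDeriv i (Torus.partialDeriv j (Torus.invLaplacian (D.Hfun j t))) y := by
  have hH := fun j => isSmooth_Hfun h j ht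
  have e : D.G t = fun y => ∑ j ∈ Finset.univ, Torus.partialDeriv j (D.Hfun j t) y := funext fun y => G_eq_sum_partialDeriv_Hfun h ht y
  rw [Datum.zeta, e, show (fun y => ∑ j ∈ Finset.univ, Torus.partialDeriv j (D.Hfun j t) y) = ∑ j ∈ Finset.univ, Torus.partialDeriv j (D.Hfun j t)
      from by funext y; simp [Finset.sum_apply],
    Torus.invLaplacian_finset_sum _ (fun j _ => (hH j).partialDeriv j),
    show (∑ j ∈ Finset.univ, Torus.invLaplacian (Torus.partialDeriv j (D.Hfun j t))) =
      fun y => ∑ j ∈ Finset.univ, Torus.invLaplacian (Torus.partialDeriv j (D.Hfun j t)) y from by funext y; simp [Finset.sum_apply],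
    Torus.partialDeriv_finset_sum Finset.univ fun j _ => (Torus.isSmooth_invLaplacian ((hH j).partialDeriv j)).isContDiff (by simp)]
  refine Finset.sum_congr rfl fun j _ => ?_
  congr 1
  funext z
  rw [← Torus.partialDeriv_invLaplacian (hH j) j z]

/-- `∫ H_j² ≤ N ∑_x μ'⁻² 9 ∫F_x²`-type bound: `∫ H_j² ≤ 9 N² μ'⁻² A₀⁴ Bκμ²`. [folklore] -/
theorem integral_Hfun_sq_le (hA : D.AmpBounds A₀ A₁ A₂ H₁ H₂) (j : Fin 3) {t : ℝ} (ht : t ∈ Icc 0 D.T) :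
    ∫ y, D.Hfun j t y ^ 2 ≤ NN * (NN * (9 * (D.mup⁻¹) ^ 2 * (A₀ ^ 4 * (B * D.κ * D.μ ^ 2)))) := by
  obtain ⟨hμ, hκ, hσ, hmup, -⟩ := pos h
  have hcF : ∀ x, Continuous fun y => D.F x t y := fun x => (isSmooth_F h x ht).continuous
  have hpt : ∀ y, D.Hfun j t y ^ 2 ≤ NN * ∑ x, 9 * (D.mup⁻¹) ^ 2 * D.F x t y ^ 2 := by
    intro y
    calc D.Hfun j t y ^ 2 = (∑ x, (D.mup⁻¹ * (dir x j : ℝ)) * D.F x t y) ^ 2 := rfl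
      _ ≤ NN * ∑ x, ((D.mup⁻¹ * (dir x j : ℝ)) * D.F x t y) ^ 2 := sq_sum_le _
      _ ≤ NN * ∑ x, 9 * (D.mup⁻¹) ^ 2 * D.F x t y ^ 2 := by
          refine mul_le_mul_of_nonneg_left (Finset.sum_le_sum fun x _ => ?_) (by linarith [one_le_NN])
          rw [mul_pow, mul_pow]
          have : ((dir x j : ℤ) : ℝ) ^ 2 ≤ 9 := by
            have := abs_dir_le x j; rw [← sq_abs]; nlinarith [abs_nonneg ((dir x j : ℤ) : ℝ)]
          nlinarith [sq_nonneg (D.mup⁻¹), sq_nonneg (D.F x t y), mul_nonneg (mul_nonneg (sq_nonneg (D.mup⁻¹)) (sq_nonneg (D.F x t y))) (by norm_num : (0:ℝ) ≤ 9)]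
  calc ∫ y, D.Hfun j t y ^ 2 ≤ ∫ y, NN * ∑ x, 9 * (D.mup⁻¹) ^ 2 * D.F x t y ^ 2 :=
        integral_mono ((isSmooth_Hfun h j ht).continuous.pow 2).integrable_unitAddTorus
          ((continuous_const.mul (continuous_finsetSum _ fun x _ => continuous_const.mul ((hcF x).pow 2))).integrable_unitAddTorus) hpt
    _ = NN * ∑ x, 9 * (D.mup⁻¹) ^ 2 * ∫ y, D.F x t y ^ 2 := by
        rw [integral_const_mul, integral_finsetSum _ fun x _ =>
          (show Integrable (fun y => 9 * (D.mup⁻¹) ^ 2 * D.F x t y ^ 2) volume from (continuous_const.mul ((hcF x).pow 2)).integrable_unitAddTorus)]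
        congr 1; exact Finset.sum_congr rfl fun x _ => integral_const_mul _ _
    _ ≤ NN * (NN * (9 * (D.mup⁻¹) ^ 2 * (A₀ ^ 4 * (B * D.κ * D.μ ^ 2)))) := by
        refine mul_le_mul_of_nonneg_left (sum_le_NN_mul fun x => ?_) (by linarith [one_le_NN])
        exact mul_le_mul_of_nonneg_left (F_bounds h hB hB1 hA x ht).2.2.2 (by positivity)

/-- **Energy of `∇ζ`** (Hessian bound `‖∂ᵢ∂ⱼΔ⁻¹H‖₂ ≤ C₂‖ΔΔ⁻¹H‖₂ = C₂‖H - ∫H‖₂ ≤ 2C₂‖H‖₂`):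
`‖∂ᵢζ‖_{L²} ≤ 6 C₂ N μ'⁻¹ A₀² (Bκ)^{1/2} μ`. [cite: BuckmasterVicol2020, §7.5.4 (7.46)] -/
theorem eLpNorm_partialDeriv_zeta_le (hA : D.AmpBounds A₀ A₁ A₂ H₁ H₂) {C₂ : ℝ≥0}
    (hC₂ : ∀ w : 𝕋³ → ℝ, Torus.IsSmooth w → ∀ j k : Fin 3,
      eLpNorm (Torus.partialDeriv j (Torus.partialDeriv k w)) 2 volume ≤ C₂ * eLpNorm (Torus.laplacian w) 2 volume)
    {t : ℝ} (ht : t ∈ Icc 0 D.T) (i : Fin 3) :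
    eLpNorm (Torus.partialDeriv i (D.zeta t)) 2 volume ≤
      ENNReal.ofReal (3 * ((C₂ : ℝ) * (2 * Real.sqrt (NN * (NN * (9 * (D.mup⁻¹) ^ 2 * (A₀ ^ 4 * (B * D.κ * D.μ ^ 2)))))))) := by
  obtain ⟨hμ, hκ, hσ, hmup, -⟩ := pos h
  have hH := fun j => isSmooth_Hfun h j ht
  obtain ⟨E, hE⟩ : ∃ E : ℝ, E = NN * (NN * (9 * (D.mup⁻¹) ^ 2 * (A₀ ^ 4 * (B * D.κ * D.μ ^ 2)))) := ⟨_, rfl⟩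
  have hE0 : 0 ≤ E := by rw [hE]; have := one_le_NN; positivity
  rw [← hE]
  -- each term
  have hterm : ∀ j, eLpNorm (Torus.partialDeriv i (Torus.partialDeriv j (Torus.invLaplacian (D.Hfun j t)))) 2 volume ≤
      ENNReal.ofReal ((C₂ : ℝ) * (2 * Real.sqrt E)) := by
    intro j
    have hφ : Torus.IsSmooth (Torus.invLaplacian (D.Hfun j t)) := Torus.isSmooth_invLaplacian (hH j)
    refine (hC₂ _ hφ i j).trans ?_
    have eL : Torus.laplacian (Torus.invLaplacian (D.Hfun j t)) = fun y => D.Hfun j t y - ∫ z, D.Hfun j t z :=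
      funext (Torus.laplacian_invLaplacian (hH j))
    rw [eL]
    have h2 : eLpNorm (fun y => D.Hfun j t y - ∫ z, D.Hfun j t z) 2 volume ≤ ENNReal.ofReal (2 * Real.sqrt E) := by
      have hsq : ∫ y, ‖D.Hfun j t y‖ ^ 2 ≤ E := by
        have h0 := integral_Hfun_sq_le h hB hB1 hA j ht
        rw [← hE] at h0
        simpa [Real.norm_eq_abs, sq_abs] using h0
      have hL2 : eLpNorm (D.Hfun j t) 2 volume ≤ ENNReal.ofReal (Real.sqrt E) := Torus.eLpNorm_two_le_ofReal_sqrt (hH j).continuous hsq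
      have hmean : |∫ z, D.Hfun j t z| ≤ Real.sqrt E := by
        have h1 : |∫ z, D.Hfun j t z| ≤ ∫ z, ‖D.Hfun j t z‖ := by
          rw [← Real.norm_eq_abs]; exact norm_integral_le_integral_norm _
        exact h1.trans (by simpa using integral_norm_le_sqrt (hH j).continuous hsq)
      calc eLpNorm (fun y => D.Hfun j t y - ∫ z, D.Hfun j t z) 2 volume
          ≤ eLpNorm (D.Hfun j t) 2 volume + eLpNorm (fun _ : 𝕋³ => ∫ z, D.Hfun j t z) 2 volume :=
            eLpNorm_sub_le (hH j).continuous.aestronglyMeasurable aestronglyMeasurable_const (by norm_num)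
        _ ≤ ENNReal.ofReal (Real.sqrt E) + ENNReal.ofReal (Real.sqrt E) := by
            refine add_le_add hL2 ?_
            exact Torus.eLpNorm_le_of_forall_norm_le (fun y => by rw [Real.norm_eq_abs]; exact hmean) 2
        _ = ENNReal.ofReal (2 * Real.sqrt E) := by rw [← ENNReal.ofReal_add (Real.sqrt_nonneg _) (Real.sqrt_nonneg _)]; ring_nf
    calc (C₂ : ℝ≥0∞) * eLpNorm (fun y => D.Hfun j t y - ∫ z, D.Hfun j t z) 2 volume ≤ (C₂ : ℝ≥0∞) * ENNReal.ofReal (2 * Real.sqrt E) :=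
          mul_le_mul_right h2 _
      _ = ENNReal.ofReal ((C₂ : ℝ) * (2 * Real.sqrt E)) := by
          rw [ENNReal.ofReal_mul C₂.coe_nonneg, ENNReal.ofReal_coe_nnreal]
  have e : Torus.partialDeriv i (D.zeta t) = fun y => ∑ j ∈ Finset.univ, Torus.partialDeriv i (Torus.partialDeriv j (Torus.invLaplacian (D.Hfun j t))) y :=
    funext fun y => partialDeriv_zeta h ht i y
  rw [e]
  calc eLpNorm (fun y => ∑ j ∈ Finset.univ, Torus.partialDeriv i (Torus.partialDeriv j (Torus.invLaplacian (D.Hfun j t))) y) 2 volume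
      ≤ ∑ j ∈ Finset.univ, eLpNorm (Torus.partialDeriv i (Torus.partialDeriv j (Torus.invLaplacian (D.Hfun j t)))) 2 volume := by
        have := eLpNorm_sum_le (s := (Finset.univ : Finset (Fin 3))) (μ := (volume : Measure 𝕋³)) (p := 2)
          (f := fun j => Torus.partialDeriv i (Torus.partialDeriv j (Torus.invLaplacian (D.Hfun j t))))
          (fun j _ => (((Torus.isSmooth_invLaplacian (hH j)).partialDeriv j).partialDeriv i).continuous.aestronglyMeasurable) (by norm_num)
        rwa [show (∑ j ∈ Finset.univ, Torus.partialDeriv i (Torus.partialDeriv j (Torus.invLaplacian (D.Hfun j t)))) =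
          fun y => ∑ j ∈ Finset.univ, Torus.partialDeriv i (Torus.partialDeriv j (Torus.invLaplacian (D.Hfun j t))) y from by
            funext y; simp [Finset.sum_apply]] at this
    _ ≤ ∑ _j : Fin 3, ENNReal.ofReal ((C₂ : ℝ) * (2 * Real.sqrt E)) := Finset.sum_le_sum fun j _ => hterm j
    _ = ENNReal.ofReal (3 * ((C₂ : ℝ) * (2 * Real.sqrt E))) := by
        rw [Finset.sum_const, Finset.card_univ, Fintype.card_fin, nsmul_eq_mul, Nat.cast_ofNat,
          ← ENNReal.ofReal_ofNat 3, ← ENNReal.ofReal_mul (by norm_num)]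

end Datum

end JetStep

end Literature.Analysis.FluidPDE
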